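import Mathlib
import Literature.Analysis.FluidPDE.VectorCalculus

/-!
# Clause 13-R, pairing tools: (i) the vector self-induction pairing is the SCALAR Taylor-remainder operator of a component,
# (ii) the transport pairing by parts — `|∫ φ·w·y′| ≤ sup|y| · ∫|(φw)′|`
# (line `rate_bordered_split` of crux `Clause13RNearStraightL`, stmt-NavierStokesRegularity-23612, STUB R; items 4 and 6 of DIAG-23612-rate-row-leafhand3-g0)

Route `FilamentSkeletonRss`, Variant A1R.  The window pairing for the rate row (memo `CENSUS-23610-side-23612-g16.md` (m5)) pairs the closed form of
`DT·Y` (`…Clause13LinearisedMapClauses`) with a weight `φ(τ)·b̂`.  Two typing-agnostic steps of that computation: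

* `deriv_inner_cross` / `inner_integral_smul_cross_taylor` — for constant vectors `t, b`, the pairing of the (model) self term
  `∫ K(τ−σ) • t × (Y τ − Y σ − (τ−σ)•Y′σ) dσ` with `b` is the scalar Taylor-remainder operator applied to the component
  `y(σ) = ⟪b, t × Y σ⟫`: `⟪b, ∫ …⟫ = ∫ K(τ−σ)(y τ − y σ − (τ−σ) y′σ) dσ` (so B2 `taylorRemainderOp_eq`, the affine annihilator
  `…Clause13RAffineAnnihilator` and the symmetry `…Clause13RTaylorRemainderSymmetry` apply componentwise);
* `integral_mul_mul_deriv_eq_neg` / `abs_integral_mul_mul_deriv_le` — the transport term `−w·Y′` paired with a compactly supported `C¹` weight: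
  `∫ φ w y′ = −∫ (φw)′ y` and hence `|∫ φ w y′| ≤ B·∫|(φw)′|` when `|y| ≤ B` (no derivative of `y` is charged — the J-currency controls `sup‖Y‖` only).

Hand `leafhand-ns-filamentskeletonrs-3-g0` (LAND-ONLY); `--supports stmt-NavierStokesRegularity-23612 --as helper`.  HONEST FRAMING: one-dimensional calculus
for the MODEL/clause pairing of a HYPOTHETICAL filament skeleton on the NEGATIVE side of a MODEL blow-up route; nothing here bears on Navier–Stokes
regularity or blow-up; STUB R is NOT proved here.
-/

noncomputable section

open MeasureTheory Filter Topology Set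
open scoped RealInnerProductSpace
open Literature.Analysis.FluidPDE

namespace Summit.NavierStokesRegularity.NavierStokesRegularity.Theorems.Clause13RPairingTools
set_option linter.dupNamespace false

/-! ## §1 Vector self term → scalar component -/

/-- The component `σ ↦ ⟪b, t × Y σ⟫` of a differentiable field has derivative `⟪b, t × Y′σ⟫`. [folklore] -/
theorem deriv_inner_cross (t b : EuclideanSpace ℝ (Fin 3)) {Y : ℝ → EuclideanSpace ℝ (Fin 3)} (hY : Differentiable ℝ Y) (σ : ℝ) :
    deriv (fun s => ⟪b, cross t (Y s)⟫) σ = ⟪b, cross t (deriv Y σ)⟫ := by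
  have hL : HasFDerivAt (fun v : EuclideanSpace ℝ (Fin 3) => ((innerSL ℝ b).comp (crossCLM t)) v)
      ((innerSL ℝ b).comp (crossCLM t)) (Y σ) := ((innerSL ℝ b).comp (crossCLM t)).hasFDerivAt
  have h := hL.comp_hasDerivAt σ (hY σ).hasDerivAt
  have h' : HasDerivAt (fun s => ⟪b, cross t (Y s)⟫) (⟪b, cross t (deriv Y σ)⟫) σ := by
    refine (h.congr_of_eventuallyEq (Eventually.of_forall fun s => ?_)).congr_deriv ?_
    · simp [Function.comp, crossCLM_apply, innerSL_apply_apply]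
    · simp [crossCLM_apply, innerSL_apply_apply]
  exact h'.deriv

/-- **The self-induction pairing is the scalar Taylor-remainder operator of a component**: for constant `t, b`, a differentiable field `Y`,
any scalar kernel `K` and a station `τ` at which the vector integrand is integrable,
`⟪b, ∫ K(τ−σ) • t × (Y τ − Y σ − (τ−σ)•Y′σ) dσ⟫ = ∫ K(τ−σ)·(y τ − y σ − (τ−σ)·y′σ) dσ`, `y = ⟪b, t × Y⟫`. [folklore] -/
theorem inner_integral_smul_cross_taylor (t b : EuclideanSpace ℝ (Fin 3)) {Y : ℝ → EuclideanSpace ℝ (Fin 3)} (hY : Differentiable ℝ Y)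
    (K : ℝ → ℝ) (τ : ℝ) (hint : Integrable (fun σ : ℝ => K (τ - σ) • cross t (Y τ - Y σ - (τ - σ) • deriv Y σ))) :
    ⟪b, ∫ σ : ℝ, K (τ - σ) • cross t (Y τ - Y σ - (τ - σ) • deriv Y σ)⟫
      = ∫ σ : ℝ, K (τ - σ) * ((fun s => ⟪b, cross t (Y s)⟫) τ - (fun s => ⟪b, cross t (Y s)⟫) σ
          - (τ - σ) * deriv (fun s => ⟪b, cross t (Y s)⟫) σ) := by
  rw [← integral_inner hint b]
  refine integral_congr_ae (Eventually.of_forall fun σ => ?_)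
  simp only []
  rw [deriv_inner_cross t b hY σ, inner_smul_right]
  have hlin : cross t (Y τ - Y σ - (τ - σ) • deriv Y σ) = cross t (Y τ) - cross t (Y σ) - (τ - σ) • cross t (deriv Y σ) := by
    rw [← crossCLM_apply, map_sub, map_sub, map_smul]; rfl
  rw [hlin, inner_sub_right, inner_sub_right, inner_smul_right]

/-! ## §2 The transport pairing by parts -/

/-- **Transport pairing by parts**: for `φ ∈ C¹` with compact support and `w, y ∈ C¹`, `∫ φ w y′ = −∫ (φw)′ y`. [folklore] -/
theorem integral_mul_mul_deriv_eq_neg {φ w y : ℝ → ℝ} (hφ : ContDiff ℝ 1 φ) (hφs : HasCompactSupport φ) (hw : ContDiff ℝ 1 w)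
    (hy : ContDiff ℝ 1 y) :
    ∫ σ : ℝ, φ σ * w σ * deriv y σ = - ∫ σ : ℝ, deriv (fun s => φ s * w s) σ * y σ := by
  have hu : ContDiff ℝ 1 (fun s => φ s * w s) := hφ.mul hw
  have hus : HasCompactSupport (fun s => φ s * w s) := hφs.mul_right
  have huc : Continuous (fun s => φ s * w s) := hu.continuous
  have hu'c : Continuous (deriv (fun s => φ s * w s)) := hu.continuous_deriv le_rfl
  have hyc : Continuous y := hy.continuous
  have hy'c : Continuous (deriv y) := hy.continuous_deriv le_rfl
  have hud : ∀ x, HasDerivAt (fun s => φ s * w s) (deriv (fun s => φ s * w s) x) x :=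
    fun x => ((hu.differentiable (by norm_num)) x).hasDerivAt
  have hyd : ∀ x, HasDerivAt y (deriv y x) x := fun x => ((hy.differentiable (by norm_num)) x).hasDerivAt
  have h1 : Integrable ((fun s => φ s * w s) * deriv y) :=
    Continuous.integrable_of_hasCompactSupport (huc.mul hy'c) hus.mul_right
  have h2 : Integrable (deriv (fun s => φ s * w s) * y) :=
    Continuous.integrable_of_hasCompactSupport (hu'c.mul hyc) hus.deriv.mul_right
  have h3 : Integrable ((fun s => φ s * w s) * y) :=
    Continuous.integrable_of_hasCompactSupport (huc.mul hyc) hus.mul_right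
  have key := integral_mul_deriv_eq_deriv_mul_of_integrable (u := fun s => φ s * w s) (v := y)
    (u' := deriv (fun s => φ s * w s)) (v' := deriv y) (fun x _ => hud x) (fun x _ => hyd x) h1 h2 h3
  simpa using key

/-- **The transport term costs no derivative of `y`**: `|∫ φ w y′| ≤ B · ∫ |(φw)′|` whenever `|y| ≤ B`. [folklore] -/
theorem abs_integral_mul_mul_deriv_le {φ w y : ℝ → ℝ} {B : ℝ} (hφ : ContDiff ℝ 1 φ) (hφs : HasCompactSupport φ) (hw : ContDiff ℝ 1 w)
    (hy : ContDiff ℝ 1 y) (hyb : ∀ σ, |y σ| ≤ B) :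
    |∫ σ : ℝ, φ σ * w σ * deriv y σ| ≤ B * ∫ σ : ℝ, |deriv (fun s => φ s * w s) σ| := by
  rw [integral_mul_mul_deriv_eq_neg hφ hφs hw hy, abs_neg]
  have hB : 0 ≤ B := (abs_nonneg _).trans (hyb 0)
  have hu : ContDiff ℝ 1 (fun s => φ s * w s) := hφ.mul hw
  have hus : HasCompactSupport (fun s => φ s * w s) := hφs.mul_right
  have hu'c : Continuous (deriv (fun s => φ s * w s)) := hu.continuous_deriv le_rfl
  have hint : Integrable (fun σ => |deriv (fun s => φ s * w s) σ|) :=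
    (Continuous.integrable_of_hasCompactSupport hu'c hus.deriv).abs
  calc |∫ σ : ℝ, deriv (fun s => φ s * w s) σ * y σ|
      ≤ ∫ σ : ℝ, |deriv (fun s => φ s * w s) σ * y σ| := by
        simpa [Real.norm_eq_abs] using norm_integral_le_integral_norm (fun σ : ℝ => deriv (fun s => φ s * w s) σ * y σ)
    _ ≤ ∫ σ : ℝ, |deriv (fun s => φ s * w s) σ| * B := by
        refine integral_mono_of_nonneg (Eventually.of_forall fun σ => abs_nonneg _) (hint.mul_const B)
          (Eventually.of_forall fun σ => ?_)
        simp only []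
        rw [abs_mul]
        exact mul_le_mul_of_nonneg_left (hyb σ) (abs_nonneg _)
    _ = B * ∫ σ : ℝ, |deriv (fun s => φ s * w s) σ| := by rw [integral_mul_const, mul_comm]

end Summit.NavierStokesRegularity.NavierStokesRegularity.Theorems.Clause13RPairingTools

end
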